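import Mathlib.Logic.Equiv.Fin.Basic
import Mathlib.Data.List.OfFn
import Mathlib.Data.List.GetD
import Mathlib.Tactic.Ring
import HarnessLib

/-!
# Block tuples: vectors of `t` blocks of length `m` as `Fin (t·m) → σ`, and strings read blockwise

Trunk `CplxCore`, a small shared toolkit (Mathlib-only imports). Counting arguments about coin
strings and witness strings (Stockmeyer's `t`-fold products in `PostBPPHashing.lean`; the
block-structured parity witnesses of Toda's theorem) cut a string of length `t·m` into `t`
consecutive blocks of length `m`. On the `Fintype` side this is the currying equivalence along
`finProdFinEquiv`, for an arbitrary alphabet `σ` (namespace `Literature.CplxCore.Blocks`):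

* `blkIx j e = j·m + e` (as `Fin (t·m)`), `blk Y j` — block `j` of `Y : Fin (t·m) → σ`;
* `tupleEquiv t m : (Fin t → Fin m → σ) ≃ (Fin (t·m) → σ)` with `blk (tupleEquiv f) j = f j`
  and `(tupleEquiv t m).symm = blk` (`tupleEquiv_symm_apply`, `rfl`), so that sets of vectors
  defined blockwise are images of `Fintype.piFinset`s and have product cardinality.
  This is the same equivalence, with the same `finProdFinEquiv (j, e)` convention, as
  `Literature.Computability.AlgebraicComplexity.flattenWord` of `AlgebraicComplexity/Polarization.lean` (which sits on top of the
  GCT files and is not importable into this toolkit); `tupleEquiv` supersedes it — librarian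
  retarget;
* `encFn n F` — the string `[F 0, …, F (n-1)]`, read back by `getD` (`getD_encFn`), the reading
  lemma `getD_ofFn` for `List.ofFn` — stated once here in the generality of
  `KarpLipton.getD_ofFn` (`KarpLipton.lean`; `Kannan.getD_ofFn` of `KannanLanguage.lean` is its
  `Bool`/`false` case), both of which it supersedes — librarian retarget — and the index
  arithmetic `blockIndex_lt`, `div_mod_block` for addresses `k·B + c`.

## References

* S. Arora, B. Barak, *Computational Complexity: A Modern Approach*, CUP 2009, §0.1 (strings and
  tuples), §7.4.1 (independent blocks of coins).
-/

namespace Literature.Computability.Complexity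

/-- Reading a list given as `List.ofFn f` inside its range (general value type and default;
supersedes `KarpLipton.getD_ofFn` and `Kannan.getD_ofFn`). [folklore] -/
theorem getD_ofFn {α : Type*} {m : ℕ} (f : Fin m → α) (d : α) {i : ℕ} (hi : i < m) :
    (List.ofFn f).getD i d = f ⟨i, hi⟩ := by
  simp [List.getD_eq_getElem?_getD, hi]

/-- Index arithmetic: `k·B + c < (k + 1)·B ≤ K·B` for `c < B`, `k < K`. [folklore] -/
theorem blockIndex_lt {B k K c : ℕ} (hc : c < B) (hk : k < K) : k * B + c < K * B := by
  calc k * B + c < k * B + B := by omega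
    _ = (k + 1) * B := by ring
    _ ≤ K * B := Nat.mul_le_mul_right B hk

/-- Index arithmetic: quotient and remainder of `k·B + c` by `B` for `c < B`. [folklore] -/
theorem div_mod_block {B k c : ℕ} (hc : c < B) : (k * B + c) / B = k ∧ (k * B + c) % B = c := by
  have hB : 0 < B := by omega
  rw [Nat.add_comm]
  exact ⟨by rw [Nat.add_mul_div_right _ _ hB, Nat.div_eq_of_lt hc, Nat.zero_add],
    by rw [Nat.add_mul_mod_self_right, Nat.mod_eq_of_lt hc]⟩

variable {σ : Type*}

/-- The string encoding a function on `Fin n` (so that `getD` reads it back). [folklore] -/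
def encFn (n : ℕ) (F : ℕ → σ) : List σ := List.ofFn fun q : Fin n => F q

/-- Length of `encFn`. [folklore] -/
@[simp] theorem length_encFn (n : ℕ) (F : ℕ → σ) : (encFn n F).length = n := by simp [encFn]

/-- Reading `encFn` back. [folklore] -/
theorem getD_encFn {n : ℕ} (F : ℕ → σ) {d : σ} {q : ℕ} (hq : q < n) : (encFn n F).getD q d = F q :=
  getD_ofFn _ d hq

namespace Blocks

/-- Position of entry `e` of block `j` in a vector of `t` blocks of length `m` (`= j·m + e`).
[folklore] -/
def blkIx {t m : ℕ} (j : Fin t) (e : Fin m) : Fin (t * m) := finProdFinEquiv (j, e)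

/-- The value of `blkIx`. [folklore] -/
@[simp] theorem blkIx_val {t m : ℕ} (j : Fin t) (e : Fin m) : (blkIx j e : ℕ) = j * m + e := by
  simp [blkIx, finProdFinEquiv, Nat.mul_comm, Nat.add_comm]

/-- Block `j` of a vector of `t` blocks of length `m`. [folklore] -/
def blk {t m : ℕ} (Y : Fin (t * m) → σ) (j : Fin t) : Fin m → σ := fun e => Y (blkIx j e)

/-- The tupling equivalence `(Fin t → Fin m → σ) ≃ (Fin (t·m) → σ)` by blocks (inverse `blk`);
the same map as `Literature.CplxAlg.flattenWord t m`, which it supersedes. [folklore] -/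
def tupleEquiv (t m : ℕ) : (Fin t → Fin m → σ) ≃ (Fin (t * m) → σ) where
  toFun f c := f (finProdFinEquiv.symm c).1 (finProdFinEquiv.symm c).2
  invFun := blk
  left_inv f := by
    funext j e
    simp [blk, blkIx]
  right_inv Y := by
    funext c
    simp only [blk, blkIx, Prod.mk.eta, Equiv.apply_symm_apply]

/-- The blocks of a tupled family are its members. [folklore] -/
@[simp] theorem blk_tupleEquiv {t m : ℕ} (f : Fin t → Fin m → σ) (j : Fin t) : blk (tupleEquiv t m f) j = f j :=
  congr_fun ((tupleEquiv t m).left_inv f) j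

/-- Tupling the blocks of a vector gives it back. [folklore] -/
@[simp] theorem tupleEquiv_blk {t m : ℕ} (Y : Fin (t * m) → σ) : tupleEquiv t m (blk Y) = Y :=
  (tupleEquiv t m).right_inv Y

/-- Untupling a vector gives its blocks (definitional). [folklore] -/
@[simp] theorem tupleEquiv_symm_apply {t m : ℕ} (Y : Fin (t * m) → σ) : (tupleEquiv t m).symm Y = blk Y := rfl

/-- The entries of a tupled family: position `j·m + e` holds `f j e`. [folklore] -/
theorem tupleEquiv_apply_blkIx {t m : ℕ} (f : Fin t → Fin m → σ) (j : Fin t) (e : Fin m) :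
    tupleEquiv t m f (blkIx j e) = f j e :=
  congr_fun (blk_tupleEquiv f j) e

/-- **Blocks of a string read as a vector**: block `j` of the vector `c ↦ v[o + c]` read off a
string `v` at offset `o` (default `d`) is `e ↦ v[o + j·m + e]`. [folklore] -/
theorem blk_getD (v : List σ) (o : ℕ) (d : σ) {t m : ℕ} (j : Fin t) :
    blk (fun c : Fin (t * m) => v.getD (o + c) d) j = fun e : Fin m => v.getD (o + (j * m + e)) d := by
  funext e
  simp [blk]

end Blocks

end Literature.Computability.Complexity
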